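import Literature.MathematicalPhysics.QuantumFieldTheory.Balaban1983to89.B8SockSP5uProviderSrc
import Literature.MathematicalPhysics.QuantumFieldTheory.Balaban1983to89.B8SockP5uEAssemblyBSrcGamma

/-!
# `Balaban1983to89.B8SockSP5uProviderSrcGamma` — [Balaban1985RegularSpaces] THE N05 KNIT's SOURCED UNIQUENESS SOCKET `SP5u` (Prop. 5 (1.109) at Theorem 8's
# gauge condition (1.146)) IN THE REPAIRED (E) CURRENCY, PROVIDED AT ONE `Ω 0 = univ` MEMBER, EDITION γ — PRINT's BOX LAW «box ⊂ Ω_{j−1}» ((1.31) p. 82)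
# for the class read by the sourced b9 socket, the socket text's (1.35) antecedent in the p. 77 guard: dag-n05-d's `B8SockSP5uProviderSrc.sp5uE_of_lettersUB_src`
# re-run on the γ body `B8SockP5uEAssemblyBSrcGamma.sockP5uE_body_of_join_b_src_γ`

statement-level skeleton of published theorems with citation tags; proofs where landed; nothing here is a claim about the Yang–Mills mass gap

T. Bałaban, *Spaces of regular gauge field configurations on a lattice and gauge fixing conditions*, Commun. Math. Phys. **99** (1985) 75–102
`[Balaban1985RegularSpaces]` ("B8"; printed page = PDF page + 74): Prop. 5 (1.109) p. 94, Thm 4 p. 88 («exactly one») ∕ p. 95, Thm 8 (1.146) p. 101, (1.31) +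
(1.35) p. 82, p. 77, Prop. 3 p. 87, (1.61) p. 86; [3] = [Balaban1985Averaging] Prop. 4 p. 36; [4] = [Balaban1985BackgroundPropagators] Thm 3.1 p. 397, Thm 3.3 p. 398.
PDF held: `paper:balaban1985-cmp99-regular-spaces-gauge-fixing`.  STATUS: published, refereed.

CITATION HEADER (lean-in-tree rule).  Cell `pub-ymgap` (YM Track A, DAG node N05 = [B8], HUMAN RULING D-0062 ∕ D-0149 width seats), seat
`pub-ymgap-dag-n05-w4` (g0): the sourced Prop-5 socket twins HANDED OVER by dag-n05-d g10 (cell bus 2026-08-27, l.24117), W-SEAT-START-LIST v3 §n05 item 4.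
WHY THIS FILE.  `B8SockSP5uProviderSrc.sp5uE_of_lettersUB_src` (dag-n05-d g5, F22) provides the knit's sourced uniqueness socket `SP5u` (ρ3 text = `SockP5uE` at
`B₈` with the gauge predicate `LanF146 … φ k`) at one `Ω 0 = univ` member from the guarded uniqueness letters `SLetUB`, the sourced b9 socket `SH59src` over the
class `Λb`, the member laws and dag-n04-b's windows family — over the «box ⊂ Ω_j» law (unsatisfiable at nested members: dag-n05-c p572834 ∕ p576185, dag-n05-d
p585094).  THIS FILE is its edition γ: ★ `sp5uE_of_lettersUB_src_γ` = the parent VERBATIM except — the member's class law `hbox` under «box ⊂ Ω_{j−1}»; the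
CONCLUSION's (1.35) antecedent in print's p. 77 guard «box ⊂ Ω (j − 1)» (the text of this seat's `B8LeafModelZdSockP5uEGamma.SockP5uEγ` with `IsLandau138W ↦ LanF146`,
LOCATED-SOCK135: only this text has a provider over print's class); a fifth hypothesis family `hwinγ` (the five γ windows, `B8SockP5uEProviderGamma.gammaWindows_of_guard`
at `B₈`); body `B8SockP5uEAssemblyBSrcGamma.sockP5uE_body_of_join_b_src_γ`.  The knit's `SH59src` hypothesis is consumed in ITS OWN text (its «box ⊂ Ω_j»-guarded (1.35)
antecedent follows from the γ one because `Ω` is antitone) — so dag-n06-b's univ γ supplier `B9SupplySockB9P3ZdGammaUniv.sockH59srcP_univ_explicit_on_lin` feeds it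
unchanged.  Kind «kernel-checked proof», one theorem, no `def`, no existing module modified.

HONEST SCOPE ∕ A6.  Assembly by name; nothing of [4] (the letters `SLetUB` and the sourced b9 socket `SH59src` over the PARAMETRIC class `Λb` are HYPOTHESES — the
latter false over a «box ⊂ Ω_j» class at nested members, = print's sourced (1.59) over `cubeLamBP'` ∕ `towerBondsP`, open, N06 content at `m ≥ 1`), of Sect. E or of
Proposition 5 beyond the composition is asserted; windows displayed, not discharged; `Ω 0 = univ` sub-family; `d ≥ 2`, `L ≥ 2`.  No joint-satisfiability claim.
Count-neutral; N05 NOT discharged; no count claim; one finite `𝕋⁴` programme at fixed `ε`, Bałaban as printed; the Yang–Mills mass gap (Clay) is NOT proved by any of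
this — R4 closes the conditional finite-`𝕋⁴` rung `BalabanLadder.UV` only; nothing continuum ∕ ℝ⁴ ∕ OS.  No `sorry`, no `def`, no `instance`, no `notation`.
Unit `pub-ymgap-dag-n05-w4` (g0), 2026-08-28.

RELATED IN THE TREE, NOT DUPLICATED: `B8SockSP5uProviderSrc` (dag-n05-d; «box ⊂ Ω_j» edition), `B8SockP5uEProviderGamma` (this seat; un-sourced γ provider + the γ windows
lemma `gammaWindows_of_guard`, which supplies `hwinγ` at `B₈`), `B8SockP5uEAssemblyBSrcGamma` (this seat; the body — USED), `B8LeafModelZdSockP5uEGamma` (this seat; the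
socket text whose (1.35) guard the conclusion copies), `B8SockSP5UniformThresholdsSrc` (dag-n05-d; the member-uniform thresholds — its edition γ follows).
-/

noncomputable section

open NormedSpace

namespace Literature.MathematicalPhysics.QuantumFieldTheory.Balaban1983to89.B8SockSP5uProviderSrcGamma

open Complex (I)
open MatrixLog B7Prop1Explicit B7Prop2Explicit B7Prop1Local B7Eq92Concrete
open B7Prop2Explicit (C0 c2')
open B7Prop3Flat (c3)
open B7Prop10General (C6 C4G)
open B7Prop9Flat (C5')
open B7Eq78Linearization (conjR zdBlocking QprimeIter)
open B8Ineq132 (covDerivFwd covDeriv InAk)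
open B8Eq119TwistedAxial (Restr129 InAx bgT)
open B8Eq184Proof (gaugeExp cfgExp)
open B8Lemma1NonAbelian (mulCfg)
open B8Eq140Level (SideTouches)
open B8Eq146AExpansion (iEta expCfg)
open B8Ineq130 (tlo thi)
open B8Thm2LogB (blockTop)
open B8Eq138LandauZd (InR138 covDivB covLap QT logCfg)
open B8Ineq125Concrete (C2p)
open B8Eq1117Concrete (XSpace)
open B8Eq155JBound (Jcur wsup wsup_nonneg)
open B7Prop4GeneralLevels (linCovIter)
open B8ScaledSupNorm (bondNorm msup Bdd msup_nonneg weight_mul_norm_le_msup weight_neg_natCast)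
open B8Prop5ContractionKLevel (Bd2 Mc Kc)
open B8LambdaSpaceKLevel (wt)
open B8LanF146 (LanF146)
open B8Thm4AtLandau138 (mgauge_mgauge_inv)
open B8SockP5uEAssemblyBSrc (sockP5uE_body_of_join_b_src)
open B8SockP5uEAssemblyBSrcGamma (sockP5uE_body_of_join_b_src_γ)

-- `Site` alone could resolve to the torus sites of `Setup.lean`; re-export the `ℤ^d` sites of `B7Prop1Explicit`.
export B7Prop1Explicit (Site)

variable {d : ℕ} {𝔸 : Type*} [CStarAlgebra 𝔸] [Nontrivial 𝔸]
variable {L : ℕ} {η : ℝ} {k : ℕ} {Ω : ℕ → Set (Site d)} {Λs : ℕ → ℕ → Set (Site d)} {Λb : ℕ → ℕ → Set (Site d × Fin d)}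
  {B₀ B₀' B₈ B₀'H B₂' BG BR cL cP γ γ' α₄ cu : ℝ}

/-- ★ **EDITION γ (print's box law «box ⊂ Ω_{j−1}» for the sourced b9 socket's class `Λb`; the socket text's (1.35) antecedent in the p. 77 guard = `SockP5uEγ`'s; the γ windows family `hwinγ`; body `sockP5uE_body_of_join_b_src_γ`; the knit's `SH59src` hypothesis is consumed VERBATIM — its «box ⊂ Ω_j»-guarded (1.35) antecedent follows from the γ one since `Ω` is antitone) OF: **THE KNIT's SOURCED UNIQUENESS SOCKET `SP5u` IN THE REPAIRED (E) CURRENCY, AT ONE `Ω 0 = univ` MEMBER, PROVIDED** (Prop. 5 (1.109) at Theorem 8's gauge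
condition (1.146), for the datum `u₁` of Theorem 4's uniqueness paragraph): for all `α₀, α₁ > 0` with `α₀ + α₁ ≤ c_P`, all unitary `U₀, U′`, every admitted
source `φ`, under (1.33)–(1.35) and the side law, for every unitary `u₁ = 1` off `Ω₀` with (1.29) whose `U₁ = U′^{u₁⁻¹}` satisfies `LanF146 … φ k` and the
(1.62)-shape at `c⋆₈ = 5dLB₈(α₀ + α₁)`: two competitors `v = e^{iλ}`, `w = e^{iμ}` in print's domain «|λ|, |Dλ|₍₋₁₎ < c_u» (read at every site and on every
bond of `SideTouches (Ω j)`), both putting `U₁` in the (1.146)-gauge at level `k` with (1.29), are EQUAL.  From the guarded uniqueness letters `SLetUB`, the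
sourced b9 socket `SH59`, the member laws and the displayed windows `hwin`.
[cite: Balaban1985RegularSpaces, Prop. 5 (1.109) p.94, Thm 4 p.88 («exactly one»), p.95, Thm 8 (1.146) p.101; Balaban1985BackgroundPropagators, Thm 3.1 p.397, Thm 3.3 p.398] -/
theorem sp5uE_of_lettersUB_src_γ (hd2 : 2 ≤ d) (hL : 2 ≤ L) (hη : 0 < η) (hk : 1 ≤ k) (hΩ : ∀ j, Ω (j + 1) ⊆ Ω j) (hΩ0 : Ω 0 = Set.univ)
    -- PRINT's box law: the locality box of a datum bond of level `j` lies in `Ω_{j−1}` ((1.31); level 0: `Ω₀`)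
    (hbox : ∀ m, m ≤ k → ∀ j, j ≤ m → ∀ c ∈ Λb m j, ∀ x, InBox (loK L j c.1) (bondHiK L j c.1 c.2) x → x ∈ Ω (j - 1))
    (hclass : ∀ m, m ≤ k → ∀ j, j ≤ m → ∀ c ∈ Λb m j,
      (c.1 ∈ Λs m j ∧ c.1 + e c.2 ∈ Λs m j) ∨
      (∃ j', j = j' + 1 ∧ (∀ x, (L : ℤ) • c.1 ≤ x → x ≤ (L : ℤ) • c.1 + blockTop L → x ∈ Λs m j') ∧ c.1 + e c.2 ∈ Λs m j) ∨
      (∃ j', j = j' + 1 ∧ c.1 ∈ Λs m j ∧ (∀ x, (L : ℤ) • (c.1 + e c.2) ≤ x → x ≤ (L : ℤ) • (c.1 + e c.2) + blockTop L → x ∈ Λs m j')))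
    (htower : ∀ j, j ≤ k → ∀ y ∈ Λs k j, ∀ x, InBox (tlo L y j) (thi L y j) x → x ∈ Ω j)
    (hB₀ : 0 < B₀) (hB₀' : 0 < B₀') (hB₀'H : 0 < B₀'H) (hB₂' : 0 ≤ B₂') (hBG : 0 ≤ BG) (hBR : 0 ≤ BR) (hγ : 0 ≤ γ) (hγ' : 0 ≤ γ')
    (hB₀8 : B₀ ≤ B₈) (hγB : 2 * (γ' * B₀) ≤ 5 * (d : ℝ) * L * B₈) (hα₄ : 0 < α₄)
    -- (i) [4]'s uniqueness letters at the top structure `(k, Λs k, U₀)`, left-inverse law of `G′` on bounded functions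
    (SLetUB : ∀ α₀ : ℝ, 0 < α₀ → α₀ ≤ cL → ∀ U₀ : Site d → Fin d → 𝔸ˣ, (∀ x κ, U₀ x κ ∈ unitaryUnits 𝔸) → InAk L k η α₀ Ω U₀ →
      ∃ (g Δ : (Site d → 𝔸) →ₗ[ℂ] (Site d → 𝔸)) (q : (Site d → 𝔸) →ₗ[ℂ] (ℕ → Site d → 𝔸)) (qs : (ℕ → Site d → 𝔸) →ₗ[ℂ] (Site d → 𝔸))
        (Aw c : (ℕ → Site d → 𝔸) →ₗ[ℂ] (ℕ → Site d → 𝔸)) (H' : XSpace d k 𝔸 →ₗ[ℂ] (Site d → 𝔸)),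
        (∀ x : Site d → 𝔸, (∃ C : ℝ, ∀ y, ‖x y‖ ≤ C) → g (Δ x + qs (Aw (q x))) = x) ∧ (∀ φ, qs (c (q (g (g (qs φ))))) = qs φ) ∧
        (∀ (f : Site d → 𝔸), ∀ x ∈ Ω 0, Δ f x = covLap η U₀ ((Ω 0).indicator f) x) ∧
        (∀ (μ : ℕ → Site d → 𝔸), ∀ x ∈ Ω 0, qs μ x = QT L k (Λs k) U₀ μ x) ∧
        (∀ (f : Site d → 𝔸) (j : ℕ), j ≤ k → ∀ y ∈ Λs k j, q f j y = QprimeIter (zdBlocking d L) (bgT L U₀) j f y) ∧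
        (∀ (f : Site d → 𝔸) (j : ℕ) (y : Site d), ¬ (j ≤ k ∧ y ∈ Λs k j) → q f j y = 0) ∧
        (∀ (X : XSpace d k 𝔸) (x : Site d), ‖H' X x‖ ≤ B₀'H * ‖X‖) ∧
        (∀ j, j ≤ k → ∀ (X : XSpace d k 𝔸), ∀ p ∈ {b : Site d × Fin d | SideTouches (Ω j) b.1 b.2},
          wt L η j * ‖covDerivFwd η U₀ p.2 (H' X) p.1‖ ≤ B₀'H * ‖X‖) ∧
        (∀ X : XSpace d k 𝔸, Bd2 L η k Ω (covLap η U₀ (H' X)) (B₂' * ‖X‖)) ∧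
        (∀ (Y : XSpace d k 𝔸) (j : ℕ) (hj : j ≤ k) (y : Site d), y ∈ Λs k j →
          QprimeIter (zdBlocking d L) (bgT L U₀) j (H' Y) y = Y (⟨j, Nat.lt_succ_of_le hj⟩, y)) ∧
        (∀ (f : Site d → 𝔸) (r : ℝ), 0 ≤ r → Bd2 L η k Ω f r →
          (∀ x, ‖g f x‖ ≤ BG * r) ∧ ∀ j, j ≤ k → ∀ p ∈ {b : Site d × Fin d | SideTouches (Ω j) b.1 b.2},
            wt L η j * ‖covDerivFwd η U₀ p.2 (g f) p.1‖ ≤ BG * r) ∧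
        (∀ (f : Site d → 𝔸) (r : ℝ), 0 ≤ r → Bd2 L η k Ω f r → Bd2 L η k Ω (f - g (qs (c (q (g f))))) (BR * r)))
    (hcPL : cP ≤ cL)
    -- (ii) THE SOURCED b9 SOCKET AT THIS MEMBER (the knit's `SH59src` at `LanF := LanF146`)
    (SH59 : ∀ α₀ α₁ : ℝ, 0 < α₀ → 0 < α₁ → α₀ + α₁ ≤ cP →
      ∀ U₀ U' : Site d → Fin d → 𝔸ˣ, (∀ x κ, U₀ x κ ∈ unitaryUnits 𝔸) → (∀ x κ, U' x κ ∈ unitaryUnits 𝔸) →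
      ∀ φ : Site d → 𝔸, ((InR138 L k η (Ω 0) (Λs k) U₀ φ ∧ (∀ x, IsSelfAdjoint (φ x)) ∧ (∀ x, x ∉ Ω 0 → φ x = 0) ∧
          Bdd L k η (-(2 : ℝ)) (fun j (x : Site d) => x ∈ Ω j) φ) ∧
        msup L k η (-(2 : ℝ)) (fun j (x : Site d) => x ∈ Ω j) φ < γ * (α₀ + α₁)) →
      InAk L k η α₀ Ω U₀ → InAk L k η α₀ Ω (mulCfg U' U₀) → (∀ m, m ≤ k → InAx L m (Λs m) U₀ (mulCfg U' U₀)) →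
      (∀ j, j ≤ k → ∀ (z : Site d) (μ : Fin d), (∀ x, InBox (loK L j z) (bondHiK L j z μ) x → x ∈ Ω j) →
        ‖(avgIter L (mulCfg U' U₀) j z μ : 𝔸) - (avgIter L U₀ j z μ : 𝔸)‖ ≤ α₁) →
      (∀ b ∈ {b : Site d × Fin d | SideTouches (Ω 0) b.1 b.2}, ‖((U' b.1 b.2 : 𝔸ˣ) : 𝔸) - 1‖ ≤ α₁) →
      (∀ m, 1 ≤ m → m ≤ k → ∀ (u : Site d → 𝔸ˣ) (W : Site d → Fin d → 𝔸ˣ) (A' : Site d → Fin d → 𝔸),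
        (∀ x, u x ∈ unitaryUnits 𝔸) → mgauge U₀ u W = U' → Restr129 L m (Λs m) U₀ u → LanF146 L k η (Ω 0) Λs U₀ φ m W →
        (∀ y τ, IsSelfAdjoint (A' y τ)) →
        (∀ j, j ≤ m → ∀ y τ, SideTouches (Ω j) y τ →
        W y τ = cfgExp η A' y τ ∧ ‖A' y τ‖ ≤ (2 * (L * (5 * (d : ℝ) * L * B₈ * (α₀ + α₁))) + 8 * (8 * B₀' * (5 * (d : ℝ) * L * B₈) * (α₀ + α₁))) * ((L : ℝ) ^ j * η)⁻¹) →
        (∀ y τ, (∀ j, j ≤ m → ¬ SideTouches (Ω j) y τ) → A' y τ = 0) →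
        msup L m η (-(1 : ℝ)) (fun j (b : Site d × Fin d) => SideTouches (Ω j) b.1 b.2) (fun b => A' b.1 b.2)
        ≤ B₀ * (bondNorm L m η (-(3 : ℝ)) Ω (fun x μ => Jcur η U₀ A' μ x)
        + wsup 1 (fun p : {p : ℕ × (Site d × Fin d) // p.1 ≤ m ∧ p.2 ∈ Λb m p.1} =>
        linCovIter L U₀ (iEta η A') p.1.1 p.1.2.1 p.1.2.2)) + γ' * B₀ * (α₀ + α₁) ∧
        msup L m η (-(2 : ℝ)) (fun j (t : Fin d × Fin d × Site d) => SideTouches (Ω j) t.2.2 t.2.1)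
        (fun t => covDerivFwd η U₀ t.1 (fun z => A' z t.2.1) t.2.2)
        ≤ B₀ * (bondNorm L m η (-(3 : ℝ)) Ω (fun x μ => Jcur η U₀ A' μ x)
        + wsup 1 (fun p : {p : ℕ × (Site d × Fin d) // p.1 ≤ m ∧ p.2 ∈ Λb m p.1} =>
        linCovIter L U₀ (iEta η A') p.1.1 p.1.2.1 p.1.2.2)) + γ' * B₀ * (α₀ + α₁)))    -- (iv) the windows family (un-sourced `uniqWindows_of_guard` shape at `B₈`, smallness windows at `hE₂ + γ(α₀ + α₁)∕2`, `c_{DA} = 2dL²c⋆₈`)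
    (hwin : ∀ α₀ α₁ : ℝ, 0 < α₀ → 0 < α₁ → α₀ + α₁ ≤ cP →
      ∀ cs cB cDA hE hE₂ lE lE₂ : ℝ, cs = 5 * (d : ℝ) * L * B₈ * (α₀ + α₁) → cB = L * cs → cDA = 2 * (d : ℝ) * (L : ℝ) ^ 2 * cs →
      hE = B₀'H * (C2p d * (40 * d * cB + α₄) * α₄) → hE₂ = B₂' * (C2p d * (40 * d * cB + α₄) * α₄) →
      lE = B₀'H * (4 * C2p d * (40 * d * cB + 2 * α₄)) → lE₂ = B₂' * (4 * C2p d * (40 * d * cB + 2 * α₄)) →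
      36 * d * B₈ * cs ≤ 1 / 2 ∧
      8 * (131072 * ((d : ℝ) + 1) ^ 2) * Real.exp (4 * (800 * ((d : ℝ) + 1) ^ 2 * ((d : ℝ) + 4)) * α₀) ≤ 16 * (131072 * ((d : ℝ) + 1) ^ 2) ∧
      2 * cs ^ 2 + 20 * d * α₀ * cs + 2 * (16 * (131072 * ((d : ℝ) + 1) ^ 2)) * cs ^ 2 ≤ α₀ + α₁ ∧
      (d : ℝ) * L * α₁ ≤ 1 / 8 ∧
      C0 d * α₀ ≤ 1 / 3 ∧ 4 * α₀ ≤ c2' d L ∧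
      Real.exp (4 * (800 * ((d : ℝ) + 1) ^ 2 * ((d : ℝ) + 4)) * α₀) * (1 + 8 * (131072 * ((d : ℝ) + 1) ^ 2) * cB) ≤ 2 ∧
      2 * cB ≤ c3 d L ∧ 2048 * (d : ℝ) * cB ≤ 1 ∧ 40 * d * cB ≤ 1 / 200 ∧
      200 * C6 d * (2 * α₄) ≤ 1 ∧ 12000 * ((d : ℝ) + 1) * L * (2 * α₄) ≤ 1 ∧
      C4G d L * (α₀ + 40 * d * cB + 4 * (2 * α₄)) ≤ 1 ∧
      1024 * ((d : ℝ) + 1) * ((d : ℝ) + 4) * L ^ 2 * α₀ ≤ 1 ∧ 32 * ((d : ℝ) + 1) ^ 2 * C6 d * L ^ 2 * α₀ ≤ 1 ∧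
      16 * d * C5' d * C6 d * (L : ℝ) ^ 2 * α₀ ≤ 1 ∧ 8 * d * C6 d * L * α₀ ≤ 1 ∧
      40 * d * cB + α₄ ≤ 1 / (4 * B₀'H * (2 * C2p d)) ∧ 2 * C6 d * (40 * d * cB + 4 * α₄) ≤ 1 / 8 ∧
      cB ≤ 1 / 13 ∧ α₄ / 4 + hE ≤ 1 / 24 ∧ α₄ / 4 + hE ≤ 1 / 140 ∧ 10 * (α₄ / 4 + hE) * BR ≤ 1 / 2 ∧
      BG * Mc d BR (α₄ / 4 + hE) cB (hE₂ + γ * (α₀ + α₁) / 2) cDA ≤ α₄ / 4 ∧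
      BG * Kc d BR (α₄ / 4 + hE) cB (hE₂ + γ * (α₀ + α₁) / 2) cDA lE₂ (1 + lE) (1 + lE) ≤ 1 / 2 ∧
      lE ≤ 1 / 2 ∧ cu + hE ≤ α₄ / 4)
    -- (v) EDITION γ: the γ windows family below `c_P` (`B8SockP5uEProviderGamma.gammaWindows_of_guard` at `B₈`)
    (hwinγ : ∀ α₀ α₁ : ℝ, 0 < α₀ → 0 < α₁ → α₀ + α₁ ≤ cP →
      ∀ cs cB : ℝ, cs = 5 * (d : ℝ) * L * B₈ * (α₀ + α₁) → cB = L * cs →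
      C0 d * ((L : ℝ) ^ 2 * α₀) ≤ 1 / 3 ∧ 4 * ((L : ℝ) ^ 2 * α₀) ≤ c2' d L ∧
      Real.exp (4 * (800 * ((d : ℝ) + 1) ^ 2 * ((d : ℝ) + 4)) * ((L : ℝ) ^ 2 * α₀)) * (1 + 8 * (131072 * ((d : ℝ) + 1) ^ 2) * cB) ≤ 2 ∧
      8 * (131072 * ((d : ℝ) + 1) ^ 2) * Real.exp (4 * (800 * ((d : ℝ) + 1) ^ 2 * ((d : ℝ) + 4)) * ((L : ℝ) ^ 2 * α₀)) * (L : ℝ) ^ 2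
        ≤ 16 * (131072 * ((d : ℝ) + 1) ^ 2) * (L : ℝ) ^ 2 ∧
      2 * cs ^ 2 + 20 * d * α₀ * cs + 2 * (16 * (131072 * ((d : ℝ) + 1) ^ 2) * (L : ℝ) ^ 2) * cs ^ 2 ≤ α₀ + α₁) :
    -- THE ρ3 `SP5u` BINDER BODY AT THIS MEMBER — EDITION γ (`B8LeafModelZdSockP5uEGamma.SockP5uEγ L B₈ cP cu η k Ω Λs` text with `IsLandau138W ↦ LanF146 … φ k`, source binder after `hU'`; (1.35) in print's p. 77 guard)
    ∀ α₀ α₁ : ℝ, 0 < α₀ → 0 < α₁ → α₀ + α₁ ≤ cP →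
      ∀ U₀ U' : Site d → Fin d → 𝔸ˣ, (∀ x κ, U₀ x κ ∈ unitaryUnits 𝔸) → (∀ x κ, U' x κ ∈ unitaryUnits 𝔸) →
      ∀ φ : Site d → 𝔸, ((InR138 L k η (Ω 0) (Λs k) U₀ φ ∧ (∀ x, IsSelfAdjoint (φ x)) ∧ (∀ x, x ∉ Ω 0 → φ x = 0) ∧
          Bdd L k η (-(2 : ℝ)) (fun j (x : Site d) => x ∈ Ω j) φ) ∧
        msup L k η (-(2 : ℝ)) (fun j (x : Site d) => x ∈ Ω j) φ < γ * (α₀ + α₁)) →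
      InAk L k η α₀ Ω U₀ → InAk L k η α₀ Ω (mulCfg U' U₀) → (∀ m, m ≤ k → InAx L m (Λs m) U₀ (mulCfg U' U₀)) →
      (∀ j, j ≤ k → ∀ (z : Site d) (μ : Fin d), (∀ x, InBox (loK L j z) (bondHiK L j z μ) x → x ∈ Ω (j - 1)) →
        ‖(avgIter L (mulCfg U' U₀) j z μ : 𝔸) - (avgIter L U₀ j z μ : 𝔸)‖ ≤ α₁) →
      (∀ b ∈ {b : Site d × Fin d | SideTouches (Ω 0) b.1 b.2}, ‖((U' b.1 b.2 : 𝔸ˣ) : 𝔸) - 1‖ ≤ α₁) →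
      ∀ u₁ : Site d → 𝔸ˣ, (∀ x, u₁ x ∈ unitaryUnits 𝔸) → (∀ x, x ∉ Ω 0 → u₁ x = 1) → Restr129 L k (Λs k) U₀ u₁ →
      LanF146 L k η (Ω 0) Λs U₀ φ k (mgauge U₀ u₁⁻¹ U') →
      (∃ A₁ : Site d → Fin d → 𝔸, ∀ j, j ≤ k → ∀ (x : Site d) (κ : Fin d), SideTouches (Ω j) x κ →
        mgauge U₀ u₁⁻¹ U' x κ = cfgExp η A₁ x κ ∧ ‖A₁ x κ‖ ≤ (5 * (d : ℝ) * L * B₈ * (α₀ + α₁)) * ((L : ℝ) ^ j * η)⁻¹) →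
      ∀ (v w : Site d → 𝔸ˣ) (lam mu : Site d → 𝔸),
      (∀ x, ((gaugeExp lam x : 𝔸ˣ) : 𝔸) = ((v x : 𝔸ˣ) : 𝔸) ∧ IsSelfAdjoint (lam x) ∧ ‖lam x‖ < cu) → (∀ x, x ∉ Ω 0 → lam x = 0) →
      (∀ j, j ≤ k → ∀ b ∈ {b : Site d × Fin d | SideTouches (Ω j) b.1 b.2}, ((L : ℝ) ^ j * η) * ‖covDerivFwd η U₀ b.2 lam b.1‖ < cu) →
      (∀ x, ((gaugeExp mu x : 𝔸ˣ) : 𝔸) = ((w x : 𝔸ˣ) : 𝔸) ∧ IsSelfAdjoint (mu x) ∧ ‖mu x‖ < cu) → (∀ x, x ∉ Ω 0 → mu x = 0) →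
      (∀ j, j ≤ k → ∀ b ∈ {b : Site d × Fin d | SideTouches (Ω j) b.1 b.2}, ((L : ℝ) ^ j * η) * ‖covDerivFwd η U₀ b.2 mu b.1‖ < cu) →
      LanF146 L k η (Ω 0) Λs U₀ φ k (mgauge U₀ v⁻¹ (mgauge U₀ u₁⁻¹ U')) → Restr129 L k (Λs k) U₀ (u₁ * v) →
      LanF146 L k η (Ω 0) Λs U₀ φ k (mgauge U₀ w⁻¹ (mgauge U₀ u₁⁻¹ U')) → Restr129 L k (Λs k) U₀ (u₁ * w) →
      ∀ x, v x = w x := by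
  intro α₀ α₁ hα₀ hα₁ hs U₀ U' hU₀ hU' φ hφ h33 h34 hAx h135 h66 u₁ hu₁ _ h129 hLan hdat v w lam mu hv _ hvD hw _ hwD hLv hRv hLw hRw
  obtain ⟨⟨hInR, hφsa, hφoff, hBdd⟩, hφn⟩ := hφ
  have hL1 : 1 ≤ L := le_trans (by norm_num) hL
  have hLr : (1 : ℝ) ≤ L := by exact_mod_cast hL1
  have hsum : 0 < α₀ + α₁ := add_pos hα₀ hα₁
  have hB₈ : 0 < B₈ := lt_of_lt_of_le hB₀ hB₀8
  -- the windows at this (α₀, α₁)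
  obtain ⟨hside, -, -, hsmall₁, hα3, hα4, hsmall, hc₃, hsc, hα₃', hs₁, hs₂, hs₃, hs₄, hs₅, hs₆, hs₇, hsm, hprod8, hcA', ha₁',
    hb₁', hθ, h103, h106, hlE, hcu⟩ := hwin α₀ α₁ hα₀ hα₁ hs _ _ _ _ _ _ _ rfl rfl rfl rfl rfl rfl rfl
  -- the γ windows at this (α₀, α₁) (the (1.56)-constant line and (1.61) are the γ ones)
  obtain ⟨hα3L, hα4L, hsmallL, hC₂L, h61L⟩ := hwinγ α₀ α₁ hα₀ hα₁ hs _ _ rfl rfl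
  -- the socket `SH59` states its (1.35) antecedent in the «box ⊂ Ω_j» guard: the γ-guard hypothesis implies it (`Ω` antitone)
  have hΩp : ∀ j, Ω j ⊆ Ω (j - 1) := by
    intro j x hx
    rcases Nat.eq_zero_or_pos j with rfl | hjp
    · simpa using hx
    · obtain ⟨i, rfl⟩ : ∃ i, j = i + 1 := ⟨j - 1, by omega⟩
      rw [Nat.add_sub_cancel]; exact hΩ i hx
  have h135' : ∀ j, j ≤ k → ∀ (z : Site d) (μ : Fin d), (∀ x, InBox (loK L j z) (bondHiK L j z μ) x → x ∈ Ω j) →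
      ‖(avgIter L (mulCfg U' U₀) j z μ : 𝔸) - (avgIter L U₀ j z μ : 𝔸)‖ ≤ α₁ :=
    fun j hj z μ hb => h135 j hj z μ fun x hx => hΩp j (hb x hx)
  -- the letters at the top structure
  have hα₀L : α₀ ≤ cL := by linarith only [hs, hcPL, hα₁]
  obtain ⟨g, Δ, q, qs, Aw, c, H', g_leftB, c_left', hΔ, hqs, hq, hq0, hH0, hH1, hH2, hQH, hG, hRbd⟩ := SLetUB α₀ hα₀ hα₀L U₀ hU₀ h33
  have hcs0 : 0 ≤ 5 * (d : ℝ) * L * B₈ * (α₀ + α₁) := by positivity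
  -- the source: size `γ(α₀ + α₁)` on the `Ω_j`, `j ≤ k` (from the `Bdd` clause of the binder and the norm premiss)
  have hmf : 0 ≤ γ * (α₀ + α₁) := by positivity
  have hf : Bd2 L η k Ω φ (γ * (α₀ + α₁)) := by
    intro j hj x hx
    have h := weight_mul_norm_le_msup hBdd hj (i := x) hx
    have e2 : (-(2 : ℝ)) = -((2 : ℕ) : ℝ) := by norm_num
    rw [e2, weight_neg_natCast L η 2 j] at h
    have hw : wt L η j ^ 2 = ((L : ℝ) ^ j * η) ^ 2 := rfl
    rw [hw]
    rw [e2] at hφn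
    exact h.trans hφn.le
  -- the datum `U₁ = U′^{u₁⁻¹}`: `U′ = U₁^{u₁}`
  have hW : mgauge U₀ u₁ (mgauge U₀ u₁⁻¹ U') = U' := mgauge_mgauge_inv U₀ U' u₁
  -- the SOURCED b9 lines at the datum, top level `k`, from `SH59` at `m = k` (monotonicity `B₀ ≤ B₈` on the non-negative bracket; `c⋆₈ ≤` the socket's constant)
  have hSg : 0 ≤ γ' * B₀ * (α₀ + α₁) := by positivity
  have SH59k : ∀ A' : Site d → Fin d → 𝔸, (∀ y τ, IsSelfAdjoint (A' y τ)) →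
      (∀ j, j ≤ k → ∀ (y : Site d) (τ : Fin d), SideTouches (Ω j) y τ →
        mgauge U₀ u₁⁻¹ U' y τ = cfgExp η A' y τ ∧ ‖A' y τ‖ ≤ (5 * (d : ℝ) * L * B₈ * (α₀ + α₁)) * ((L : ℝ) ^ j * η)⁻¹) →
      (∀ (y : Site d) (τ : Fin d), (∀ j, j ≤ k → ¬ SideTouches (Ω j) y τ) → A' y τ = 0) →
      msup L k η (-(1 : ℝ)) (fun j (b : Site d × Fin d) => SideTouches (Ω j) b.1 b.2) (fun b => A' b.1 b.2)
          ≤ B₈ * (bondNorm L k η (-(3 : ℝ)) Ω (fun x μ => Jcur η U₀ A' μ x)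
          + wsup 1 (fun p : {p : ℕ × (Site d × Fin d) // p.1 ≤ k ∧ p.2 ∈ Λb k p.1} =>
          linCovIter L U₀ (iEta η A') p.1.1 p.1.2.1 p.1.2.2)) + γ' * B₀ * (α₀ + α₁) ∧
        msup L k η (-(2 : ℝ)) (fun j (t : Fin d × Fin d × Site d) => SideTouches (Ω j) t.2.2 t.2.1)
          (fun t => covDerivFwd η U₀ t.1 (fun z => A' z t.2.1) t.2.2)
          ≤ B₈ * (bondNorm L k η (-(3 : ℝ)) Ω (fun x μ => Jcur η U₀ A' μ x)
          + wsup 1 (fun p : {p : ℕ × (Site d × Fin d) // p.1 ≤ k ∧ p.2 ∈ Λb k p.1} =>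
          linCovIter L U₀ (iEta η A') p.1.1 p.1.2.1 p.1.2.2)) + γ' * B₀ * (α₀ + α₁) := by
    intro A' hsa' hWA' hA0'
    have hbig : ∀ j, j ≤ k → ∀ (y : Site d) (τ : Fin d), SideTouches (Ω j) y τ →
        mgauge U₀ u₁⁻¹ U' y τ = cfgExp η A' y τ ∧ ‖A' y τ‖ ≤ (2 * (L * (5 * (d : ℝ) * L * B₈ * (α₀ + α₁))) +
          8 * (8 * B₀' * (5 * (d : ℝ) * L * B₈) * (α₀ + α₁))) * ((L : ℝ) ^ j * η)⁻¹ := by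
      intro j hj y τ hsd
      obtain ⟨he, hb⟩ := hWA' j hj y τ hsd
      refine ⟨he, hb.trans (mul_le_mul_of_nonneg_right ?_ (by positivity))⟩
      have h1 : (1 : ℝ) * (5 * (d : ℝ) * L * B₈ * (α₀ + α₁)) ≤ L * (5 * (d : ℝ) * L * B₈ * (α₀ + α₁)) :=
        mul_le_mul_of_nonneg_right hLr hcs0
      have h2 : 0 ≤ 8 * (8 * B₀' * (5 * (d : ℝ) * L * B₈) * (α₀ + α₁)) := by positivity
      linarith only [h1, h2, hcs0]
    obtain ⟨h1, h2⟩ := SH59 α₀ α₁ hα₀ hα₁ hs U₀ U' hU₀ hU' φ ⟨⟨hInR, hφsa, hφoff, hBdd⟩, hφn⟩ h33 h34 hAx h135' h66 k hk le_rfl u₁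
      (mgauge U₀ u₁⁻¹ U') A' hu₁ hW h129 hLan hsa' hbig hA0'
    have hX : 0 ≤ bondNorm L k η (-(3 : ℝ)) Ω (fun x μ => Jcur η U₀ A' μ x)
        + wsup 1 (fun p : {p : ℕ × (Site d × Fin d) // p.1 ≤ k ∧ p.2 ∈ Λb k p.1} =>
          linCovIter L U₀ (iEta η A') p.1.1 p.1.2.1 p.1.2.2) := by
      have ha : 0 ≤ bondNorm L k η (-(3 : ℝ)) Ω (fun x μ => Jcur η U₀ A' μ x) := by
        unfold bondNorm; exact msup_nonneg L k hη.le _ _ _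
      have hb := wsup_nonneg zero_le_one (fun p : {p : ℕ × (Site d × Fin d) // p.1 ≤ k ∧ p.2 ∈ Λb k p.1} =>
        linCovIter L U₀ (iEta η A') p.1.1 p.1.2.1 p.1.2.2)
      linarith only [ha, hb]
    have hmono := mul_le_mul_of_nonneg_right hB₀8 hX
    exact ⟨h1.trans (by linarith only [hmono]), h2.trans (by linarith only [hmono])⟩
  -- `c_{DA} = 2dL²c⋆₈ ≥ dL²(c⋆₈ + 2Sg)` since `2γ′B₀ ≤ 5dLB₈`
  have hcDAlo : (d : ℝ) * (L : ℝ) ^ 2 * (5 * (d : ℝ) * L * B₈ * (α₀ + α₁) + 2 * (γ' * B₀ * (α₀ + α₁))) ≤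
      2 * (d : ℝ) * (L : ℝ) ^ 2 * (5 * (d : ℝ) * L * B₈ * (α₀ + α₁)) := by
    have h1 : 2 * (γ' * B₀ * (α₀ + α₁)) ≤ 5 * (d : ℝ) * L * B₈ * (α₀ + α₁) := by
      have h := mul_le_mul_of_nonneg_right hγB hsum.le
      linarith only [h]
    have h2 : (0 : ℝ) ≤ (d : ℝ) * (L : ℝ) ^ 2 := by positivity
    have h3 := mul_le_mul_of_nonneg_left h1 h2
    linarith only [h3]
  -- THE SOURCED BODY (`sockP5uE_body_of_join_b_src`) at `B₀ := B₈`, `Lan := LanF146 …`, `f := φ`; each competitor's multiplier clause = `LanF146`'s first conjunct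
  exact sockP5uE_body_of_join_b_src_γ hd2 hL hη hk hΩ hΩ0 hbox hclass htower hα₀ hα₁ hB₈ rfl hα₄ hU₀ hU' h33 h34 hAx h135 hu₁ h129
    (fun n W => LanF146 L k η (Ω 0) Λs U₀ φ n W) hLan hdat hSg SH59k hmf hf hside hC₂L h61L hsmall₁ g Δ q qs Aw c g_leftB c_left' hΔ hqs hq hq0
    H' hB₀'H hB₂' hBG hBR hH0 hH1 hH2 hQH hG hRbd le_rfl le_rfl hcDAlo hα3 hα4 hα3L hα4L hsmallL hsmall hc₃ hsc hα₃' hs₁ hs₂ hs₃ hs₄ hs₅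
    hs₆ hs₇ hsm hprod8 rfl rfl rfl rfl hcA' ha₁' hb₁' hθ h103 h106 hlE hcu hv hvD hw hwD hLv.1 hRv hLw.1 hRw

#print axioms sp5uE_of_lettersUB_src_γ

end Literature.MathematicalPhysics.QuantumFieldTheory.Balaban1983to89.B8SockSP5uProviderSrcGamma

end
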